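import Summits.QuantumFields.YangMills.Theses.ThermalDescent
import Summits.QuantumFields.YangMills.Theorems.ThermalDescentHypercubeSeamGlue
import Summits.QuantumFields.YangMills.Theorems.ThermalDescentTransportIdentity
import Summits.QuantumFields.YangMills.Theorems.ThermalDescentOddTorusRPHolds
import HarnessLib

/-!
# Route `ThermalDescent`, crux `HypercubeSeam` (stmt-QuantumFields-26515) — the derived split theorem, materialised

`ThermalDescent.HypercubeSeam` was closed BY SPLIT (route rev 5): children `TransportIdentity` (stmt-QuantumFields-27342,
`ThermalDescentTransportIdentity.thermalDescent_transportIdentity`) and `OddTorusRP` (stmt-QuantumFields-27343,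
`ThermalDescentOddTorusRPHolds.thermalDescent_oddTorusRP`), glue `HypercubeSeamGlue : TransportIdentity → OddTorusRP → HypercubeSeam`
(stmt-QuantumFields-27344, `thermalDescent_hypercubeSeamGlue`).  All three are landed and kernel-checked; this file records the
composition so that the item closes on a declaration that resolves (ledger BY-SPLIT sweep 2026-08-30, director-ym R569-ym (1)).
The SqueezedSkewness copy of the same statement is `squeezedSkewness_hypercubeSeam` (`Theorems/SqueezedSkewnessHypercubeSeam.lean`).

HONEST FRAMING: an unconditional fixed-lattice transfer-matrix inequality (reflection positivity across the hypercube seam);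
nothing about the continuum limit; the Yang–Mills mass gap is NOT proved.  No `sorry`, no new axiom, no new definition.
-/

set_option autoImplicit false

namespace Summit.QuantumFields.YangMills.Theorems

/-- ★ **`ThermalDescent.HypercubeSeam` holds** (item stmt-QuantumFields-26515, BY NAME): the glue `thermalDescent_hypercubeSeamGlue`
applied to the two landed children `thermalDescent_transportIdentity` and `thermalDescent_oddTorusRP`.  The Yang–Mills mass gap
is NOT proved. -/
theorem thermalDescent_hypercubeSeam_proof :
    Summit.QuantumFields.YangMills.Theses.ThermalDescent.HypercubeSeam :=
  thermalDescent_hypercubeSeamGlue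
    Summit.QuantumFields.YangMills.Theorems.ThermalDescentTransportIdentity.thermalDescent_transportIdentity
    Summit.QuantumFields.YangMills.Theorems.ThermalDescentOddTorusRPHolds.thermalDescent_oddTorusRP

end Summit.QuantumFields.YangMills.Theorems
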